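import Summits.ABC.IUTFork.Repair.RHDiffPriced
import Literature.IUT.LogVolume.TensorPacketLicenceCellOrders
import HarnessLib

/-!
# R-H ROUND 1 row 16 «diffpriced» — TESTER file (seat abc-iut-rh-tst-5, gen 2): k2 (unramified refutation family) and k3 (window
# compatibility) for `Repair.RH.DiffPriced.HStarDiffPriced` (p458364), as kernel lemmas

PROOF-ONLY file (no definitions). HONEST FRAMING: `HStarDiffPriced` is an R-H CANDIDATE HYPOTHESIS (claim-tagged `def … : Prop` of
abc-iut-lens-transfer-3, re-homed by abc-iut-rp-s2); nothing here asserts abc proved or refuted; no side is taken on [IUTchIII] Cor. 3.12 or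
on any author; typed ≠ proved; refuted-as-typed ≠ refuted-in-print.

WHAT IS PROVED (namespace `Summit.ABC.IUTFork.Repair.RH.DiffPriced`, next to the candidate):
* k2 — `not_cell_unramified`, **`not_hStarDiffPriced_of_unramified_bad_anyPrime`** (the pair typer's
  `DiffPricedVsTameBand.not_hStarDiffPriced_of_unramified_bad`, p460055, without its `2 < p` hypothesis): a bad place `w ∣ p` of the genuine datum `pilotDataOfK D K` with
  `e_w = 1` (ANY prime `p`, also `p = 2`) refutes H⋆_𝔡 as typed: there `differentOrd = (e_w − 1)/e_w = 0` (`differentOrd_eq_of_not_dvd`),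
  so the cell at the label `j = 2 ≤ l⋆` reads `3·P_w ≤ 0` against `P_w ≥ 1` (`Cor312Prov.exists_nat_qPilot_pilotDataOfK`). This is the
  unramified(-odd) NEG family of record (`CandInternal2Real.not_mem_jsq_smul_logShell_of_unramified`, the licence's own refutation at
  `e = 1`) — H⋆_𝔡 AGREES with it (no false positive); at a genuine initial Θ-datum the stratum is empty for the bad places of record
  (`l ≤ e_w`, `Cor312Prov.l_le_ramificationIdx_int_of_over_VFbad`), so the lemma bites synthetic rows only (S-RAT).
* k3 — `cell_iff_orders` (the real cell in integer orders: `P = m_q`, `d = D/e` ⇒ `(j²−1)·m_q ≤ j·D`) and **`u2Orders_of_cell_int`**: the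
  H⋆_𝔡 cell at a label IMPLIES the R-W table test of record (WINDOW-TABLE v4.x, `verdict_U2cell`), i.e. abc-iut-w5-d180's exact U2
  diagonal-packet predicate `e·⌊(j²m_q − j·D − (j+1)·R_in)/e⌋ + (j+1)·R_out ≤ m_q` of
  `Literature.IUT.LogVolume.iota_smul_subset_packetHull_orbit_iota_smul_iff_orders`, for EVERY different exponent `D` and all lattice radii
  with `R_out ≤ R_in` (which holds at every row: `c_in ∈ log_p(𝒪^×) ∋` nothing of norm `> ‖c_out‖`). Hence «H⋆_𝔡 holds ∧ CELL-REFUTED»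
  is EMPTY by theorem, not only on the 1,959 numeric packet rows of v4.2 (0 found): H⋆_𝔡 is window-COMPATIBLE, and strictly STRONGER
  than the diagonal cell (it under-reaches 389 inhabited-side packets).
* `diagonal_subset_hull_of_cell` — the same implication pushed through the named iff: at the diagonal packet of ONE local field (any
  ramification, any `p`), the H⋆_𝔡 cell puts the q-box inside the holomorphic hull of the (Ind2)-orbit of the Θ-box.
[cite: Mochizuki2012, IUTchI Ex. 3.2 (iv) p. 71; IUTchIV Prop. 1.1 p. 9, Prop. 1.2 (i)(ii) p. 10] [cite: SerreLocalFields1979, Ch. III §6 Prop. 13]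
[cite: DupuyHilado2025, §3.3, §4.9, §4.12] [claim: Mochizuki2012, status: disputed]
-/

noncomputable section

open Set Function NumberField IsDedekindDomain
open scoped Pointwise

namespace Summit.ABC.IUTFork.Repair.RH.DiffPriced

open Literature.AnabelianGeometry.AbsoluteAnabelian Literature.IUT.LogThetaLattice Literature.IUT.LogVolume Literature.IUT.HodgeTheaters
open Literature.NumberTheory.NumberFields Literature.NumberTheory.GaloisRepresentations.Ultrametric
open Summit.ABC.IUTFork.Thm311 Summit.ABC.IUTFork.Thm311.Real Summit.ABC.IUTFork.Cor312 Summit.ABC.IUTFork.Cor312.Setting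
  Summit.ABC.IUTFork.Cor312Vol Summit.ABC.IUTFork.Cor312Prov

/-! ## §1. The cell at an unramified place, and the cell in integer orders -/

/-- **`e = 1`, `d = 0`: the different-priced cell FAILS at every label `j ≥ 2` for every `P ≥ 1`** (`(j²−1)·P ≤ 0` is false).
[folklore] -/
theorem not_cell_unramified {j : ℕ} (hj : 2 ≤ j) {P : ℝ} (hP : 1 ≤ P) : ¬ Cell j P 1 0 := by
  unfold Cell
  intro h
  have hj' : (2 : ℝ) ≤ (j : ℝ) := by exact_mod_cast hj
  have h0 : ((j : ℝ) ^ 2 - 1) * P ≤ 0 := by simpa using h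
  have h3 : (3 : ℝ) ≤ (j : ℝ) ^ 2 - 1 := by nlinarith
  have h4 : (3 : ℝ) * 1 ≤ ((j : ℝ) ^ 2 - 1) * P := mul_le_mul h3 hP (by norm_num) (by linarith)
  linarith

/-- **The cell in integer orders**: with `P = m` and `d = D/e` (`e ≠ 0`), `Cell j m e (D/e) ⟺ (j²−1)·m ≤ j·D`. [folklore] -/
theorem cell_iff_orders {e : ℕ} (he : e ≠ 0) (j : ℕ) (m D : ℤ) :
    Cell j (m : ℝ) e ((D : ℝ) / e) ↔ ((j : ℤ) ^ 2 - 1) * m ≤ (j : ℤ) * D := by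
  unfold Cell
  have he' : (e : ℝ) ≠ 0 := by exact_mod_cast he
  rw [mul_div_cancel₀ (D : ℝ) he']
  constructor
  · intro h
    have h' : ((((j : ℤ) ^ 2 - 1) * m : ℤ) : ℝ) ≤ (((j : ℤ) * D : ℤ) : ℝ) := by push_cast; exact h
    exact_mod_cast h'
  · intro h
    have h' : ((((j : ℤ) ^ 2 - 1) * m : ℤ) : ℝ) ≤ (((j : ℤ) * D : ℤ) : ℝ) := by exact_mod_cast h
    push_cast at h'
    exact h'

/-! ## §2. k3: the cell implies the U2 diagonal-packet predicate of record -/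

/-- **k3 AS A THEOREM (integer orders).** For `0 < e`, `R_out ≤ R_in` and the H⋆_𝔡 cell `(j²−1)·m ≤ j·D` at a label `j`:
`e·⌊(j²·m − j·D − (j+1)·R_in)/e⌋ + (j+1)·R_out ≤ m` — abc-iut-w5-d180's exact U2 diagonal-packet predicate (the `verdict_U2cell` column of
R-W's WINDOW-TABLE v4.x) holds. So no table row can carry «H⋆_𝔡 holds ∧ CELL-REFUTED». [folklore] -/
theorem u2Orders_of_cell_int {e m D Rin Rout : ℤ} (j : ℕ) (he : 0 < e) (hR : Rout ≤ Rin)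
    (h : ((j : ℤ) ^ 2 - 1) * m ≤ (j : ℤ) * D) :
    e * (((j : ℤ) ^ 2 * m - (j : ℤ) * D - ((j : ℤ) + 1) * Rin) / e) + ((j : ℤ) + 1) * Rout ≤ m := by
  have h1 := Int.mul_ediv_add_emod ((j : ℤ) ^ 2 * m - (j : ℤ) * D - ((j : ℤ) + 1) * Rin) e
  have h2 := Int.emod_nonneg ((j : ℤ) ^ 2 * m - (j : ℤ) * D - ((j : ℤ) + 1) * Rin) (ne_of_gt he)
  have hj : (0 : ℤ) ≤ (j : ℤ) + 1 := by positivity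
  nlinarith [mul_le_mul_of_nonneg_left hR hj]

/-- The same with `|I| = j + 1` slots written as in `iota_smul_subset_packetHull_orbit_iota_smul_iff_orders` (`M = j²·m_q` for realising
ideles, `(|I| − 1)·D = j·D`). [folklore] -/
theorem u2Orders_of_cell_card {e m D Rin Rout : ℤ} {c : ℕ} (hc : 1 ≤ c) (he : 0 < e) (hR : Rout ≤ Rin)
    (h : (((c - 1 : ℕ) : ℤ) ^ 2 - 1) * m ≤ ((c - 1 : ℕ) : ℤ) * D) :
    e * ((((c - 1 : ℕ) : ℤ) ^ 2 * m - ((c - 1 : ℕ) : ℤ) * D - (c : ℤ) * Rin) / e) + (c : ℤ) * Rout ≤ m := by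
  have hcc : (c : ℤ) = ((c - 1 : ℕ) : ℤ) + 1 := by
    rw [Nat.cast_sub hc, Nat.cast_one]; ring
  rw [hcc]
  exact u2Orders_of_cell_int (c - 1) he hR h

/-! ## §3. k2: an unramified bad place refutes H⋆_𝔡 as typed -/

variable {F K Fbar : Type} [Field F] [NumberField F] [Field K] [NumberField K] [Algebra F K] [Field Fbar]
  [Algebra F Fbar] [Algebra K Fbar] {E : WeierstrassCurve F} [E.IsElliptic] {l : ℕ} {Pb : BadPlacePredicates K}

variable (D : InitialThetaData F K Fbar E l Pb)

/-- **k2: a bad place `w ∣ p` with `e_w = 1` (ANY prime `p`, the `2 < p` of abc-iut-rh-typ-5's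
`DiffPricedVsTameBand.not_hStarDiffPriced_of_unramified_bad` dropped) REFUTES H⋆_𝔡 as typed** — there `d_w = 0` (`differentOrd_eq_of_not_dvd`),
`P_w ≥ 1` (`exists_nat_qPilot_pilotDataOfK`), and the label `j = 2 ≤ l⋆` exists (`two_le_lstar`): the cell reads `3·P_w ≤ 0`. H⋆_𝔡
thereby AGREES with the unramified NEG family of record (`CandInternal2Real.not_mem_jsq_smul_logShell_of_unramified`) and with the
licence's own refutation at `e = 1`; at genuine data the bad places have `l ≤ e_w` (`l_le_ramificationIdx_int_of_over_VFbad`), so the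
hypothesis `e_w = 1` is met by synthetic rows only. [cite: Mochizuki2012, IUTchI Ex. 3.2 (iv) p. 71; IUTchIV Prop. 1.1 p. 9]
[cite: SerreLocalFields1979, Ch. III §6 Prop. 13] [claim: Mochizuki2012, status: disputed] -/
theorem not_hStarDiffPriced_of_unramified_bad_anyPrime (pp : Nat.Primes) (w : (thetaIndex (pilotDataOfK D K)).Fibre (.inr pp))
    (hw : haveI : Fact (pp : ℕ).Prime := ⟨pp.2⟩; placeOf (pilotDataOfK D K) pp.1 w ∈ (pilotDataOfK D K).S)
    (he : haveI : Fact (pp : ℕ).Prime := ⟨pp.2⟩; (placeOf (pilotDataOfK D K) pp.1 w).asIdeal.ramificationIdx ℤ = 1) :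
    ¬ HStarDiffPriced D := by
  haveI : Fact (pp : ℕ).Prime := ⟨pp.2⟩
  intro h
  obtain ⟨P, hP, hP1, -⟩ := exists_nat_qPilot_pilotDataOfK D hw
  have hl : 1 < (pilotDataOfK D K).lstar := lt_of_lt_of_le one_lt_two (pilotDataOfK D K).two_le_lstar
  have hc := h pp ⟨1, hl⟩ w hw
  have heK : absRamificationIdx (pp : ℕ) (kOf (pilotDataOfK D K) pp.1 w) = 1 :=
    (absRamificationIdx_rescaledCompletion K (pp : ℕ) (placeOf (pilotDataOfK D K) pp.1 w)
      (natCast_mem_placeOf (pilotDataOfK D K) pp.1 w)).trans he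
  have hnd : ¬ (pp : ℕ) ∣ absRamificationIdx (pp : ℕ) (kOf (pilotDataOfK D K) pp.1 w) := by
    rw [heK, Nat.dvd_one]
    exact (Nat.Prime.one_lt pp.2).ne'
  have hd := differentOrd_eq_of_not_dvd (pp : ℕ) (kOf (pilotDataOfK D K) pp.1 w) hnd
  rw [heK, Nat.cast_one, sub_self, zero_div] at hd
  rw [hP, heK, hd] at hc
  exact not_cell_unramified (j := (1 : ℕ) + 1) (by norm_num) (by exact_mod_cast hP1) hc

/-! ## §4. The cell at the diagonal packet of one local field: q-box inside the hull (any ramification, any `p`) -/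

section Diagonal

variable (p : ℕ) [Fact p.Prime] {I : Type} [Fintype I] [DecidableEq I] [Nonempty I]
variable {L : Type} [NontriviallyNormedField L] [NormedAlgebra ℚ_[p] L] [IsUltrametricDist L] [ProperSpace L]

/-- **H⋆_𝔡 at the DIAGONAL packet of ONE local field `L` (all `|I| = j+1` slots equal; any ramification, any `p`): the cell
`(j²−1)·m_q ≤ j·D` puts the q-box inside the holomorphic hull of the (Ind2)-orbit of the Θ-box** — abc-iut-c312-5 / abc-iut-w5-d180's
exact cell `iota_smul_subset_packetHull_orbit_iota_smul_iff_orders` (realising ideles `‖t_Θ‖ = ‖ϖ‖^{j²m_q}`, `‖t_q‖ = ‖ϖ‖^{m_q}`,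
different exponent `D`, lattice radii `R_in ≥ R_out`) composed with `u2Orders_of_cell_card`. This is the diagonal packet only; the
all-packets / mixed-fibre licence is NOT claimed. [cite: Mochizuki2012, IUTchIV Prop. 1.1 p. 9, Prop. 1.2 (i)(ii) p. 10; IUTchIII Rmk. 3.9.5 (i) p. 127]
[cite: DupuyHilado2025, §4.9, §4.12] [claim: Mochizuki2012, status: disputed] -/
theorem diagonal_subset_hull_of_cell {ϖ : Lˣ} (hϖ : IsUniformizer ϖ) {Dx : ℕ}
    (hD : differentOrd p L = (Dx : ℝ) / absRamificationIdx p L) {cin cout : L}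
    (hin : ∀ o : L, ‖o‖ ≤ 1 → cin * o ∈ logUnits L)
    (hmax : ∃ (ϖ' : Lˣ) (w : L), IsUniformizer ϖ' ∧ w ∉ logUnits L ∧ ‖w‖ * ‖(ϖ' : L)‖ ≤ ‖cin‖)
    (houtΛ : cout ∈ logUnits L) (hdom : ∀ z ∈ logUnits L, ‖z‖ ≤ ‖cout‖)
    {Rin Rout : ℤ} (hRin : ‖cin‖ = ‖(ϖ : L)‖ ^ Rin) (hRout : ‖cout‖ = ‖(ϖ : L)‖ ^ Rout) (hR : Rout ≤ Rin)
    (b b' : I) {tΘ tq : L} {mq : ℤ} (hΘ : ‖tΘ‖ = ‖(ϖ : L)‖ ^ (((Fintype.card I - 1 : ℕ) : ℤ) ^ 2 * mq))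
    (hq : ‖tq‖ = ‖(ϖ : L)‖ ^ mq)
    (hcell : Cell (Fintype.card I - 1) (mq : ℝ) (absRamificationIdx p L) ((Dx : ℝ) / absRamificationIdx p L)) :
    iota p (fun _ : I => L) b' tq • (normalizedPacket p (fun _ : I => L) : Set (PacketAlgebra p (fun _ : I => L))) ⊆
      packetHull p (fun _ : I => L) (⋃ g : indTwo p (fun _ : I => L),
        g • (iota p (fun _ : I => L) b tΘ • (normalizedPacket p (fun _ : I => L) : Set (PacketAlgebra p (fun _ : I => L))))) := by
  rw [iota_smul_subset_packetHull_orbit_iota_smul_iff_orders p hϖ hD hin hmax houtΛ hdom hRin hRout b b' hΘ hq]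
  have he : 0 < absRamificationIdx p L := absRamificationIdx_pos p L
  have hcell' : Cell (Fintype.card I - 1) ((mq : ℤ) : ℝ) (absRamificationIdx p L) (((Dx : ℤ) : ℝ) / absRamificationIdx p L) := by
    simpa using hcell
  have h := (cell_iff_orders (ne_of_gt he) (Fintype.card I - 1) mq (Dx : ℤ)).1 hcell'
  exact u2Orders_of_cell_card (e := (absRamificationIdx p L : ℤ)) (m := mq) (D := (Dx : ℤ)) Fintype.card_pos
    (by exact_mod_cast he) hR h

end Diagonal

end Summit.ABC.IUTFork.Repair.RH.DiffPriced

end
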